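import Summits.KontsevichZagierPeriods.KontsevichZagierPeriods.Theses.FurushoPentagon
import Literature.NumberTheory.Transcendental.KZCubicalCalculus
import Literature.RingTheory.MvPowerSeries.ConvergentPowerSeries
import Mathlib.MeasureTheory.Integral.DominatedConvergence
import Mathlib.MeasureTheory.Integral.Pi
import Mathlib.Analysis.SpecialFunctions.Integrals.Basic
import Mathlib.Data.Finsupp.Encodable

/-!
# `SectorToKernel`, line `effective-cube-surjection`: termwise integration over the cube and
termwise restriction `xᵢ = c` of a convergent real power series (stub S3c)

Stub `stub_termwiseOfSummable` of the crux `FurushoPentagon.SectorToKernel`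
(stmt-KontsevichZagierPeriods-10813). For a real power series `F` in `M` variables with summable
majorant `∑ₐ |Fₐ| ρ^{|a|} < ∞` of polyradius `ρ > 1`, summing to `g` on the closed unit cube
`[0,1]ᴹ = KZ.cube M`, we prove the two elementary facts used to identify Ayoub's formal calculus
on `𝒪(𝔻̄ᴹ)` (`AyoubRel.intC`, `AyoubRel.restrC`) with the Kontsevich–Zagier evaluation:

* **(A) termwise integration.** `∑ₐ Fₐ ∏ⱼ (aⱼ + 1)⁻¹ = ∫_{[0,1]ᴹ} g`: every term `Fₐ xᵃ` is
  continuous on the compact cube, `∑ₐ ∫_{[0,1]ᴹ} |Fₐ xᵃ| ≤ ∑ₐ |Fₐ| < ∞`, so the integral of the sum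
  is the sum of the integrals (`MeasureTheory.hasSum_integral_of_summable_integral_norm`), and
  `∫_{[0,1]ᴹ} xᵃ = ∏ⱼ ∫₀¹ t^{aⱼ} dt = ∏ⱼ (aⱼ + 1)⁻¹` (Fubini on the product cube,
  `MeasureTheory.integral_fintype_prod_eq_prod`, and `integral_pow`).
* **(B) termwise restriction.** For `0 ≤ c ≤ 1` and `x ∈ [0,1]ᴹ` the point `(x with xᵢ ↦ c)` lies
  in the cube, where the series converges absolutely; regrouping it along the `i`-th exponent
  (`b = a + n eᵢ` with `aᵢ = 0`; `HasSum.prod_fiberwise`) gives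
  `g (x with xᵢ ↦ c) = ∑_{a, aᵢ = 0} (∑ₙ F_{a + n eᵢ} cⁿ) xᵃ`, the coefficient formula of Ayoub's
  restriction `G|_{zᵢ = c}`.

(The hypothesis `0 ≤ c ≤ 1` in (B) is necessary: `g` is only constrained on the cube, so for
`c < 0` the value `g (x with xᵢ ↦ c)` is arbitrary.)

References: J. Ayoub, *Une version relative de la conjecture des périodes de Kontsevich–Zagier*,
Ann. of Math. 181 (2015), Rem. 1.3 / §1.3; J. Ayoub, *Periods and the conjectures of
Grothendieck and Kontsevich–Zagier* (2014), Rem. 13; folklore (dominated convergence, Fubini for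
absolutely convergent series).
-/

noncomputable section

namespace Summit.KontsevichZagierPeriods.FurushoPentagon.SectorToKernel

section Helpers

open Set MeasureTheory
open MvPowerSeries (coeff)
open Literature.RingTheory.MvPowerSeries
open Literature.NumberTheory.Transcendental
open scoped NNReal ENNReal Topology

/-! ## Absolute summability on the cube -/

/-- A summable majorant of polyradius `ρ ≥ 1` gives absolutely summable coefficients
`∑ₐ |Fₐ| < ∞` (`ρ^{|a|} ≥ 1`). [folklore] -/
theorem tos_summable_norm_coeff {M : ℕ} {F : MvPowerSeries (Fin M) ℝ} {ρ : ℝ} (hρ : 1 ≤ ρ)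
    (hF : Summable fun a : Fin M →₀ ℕ => |coeff a F| * ρ ^ (a.sum fun _ e => e)) :
    Summable fun a : Fin M →₀ ℕ => ‖coeff a F‖ :=
  -- adapted from `AyoubRel.summable_norm_coeff_of_hasPolyradiusGtOne`
  Summable.of_nonneg_of_le (fun a => norm_nonneg _)
    (fun a => by
      rw [Real.norm_eq_abs]
      exact le_mul_of_one_le_right (abs_nonneg _) (one_le_pow₀ hρ)) hF

/-- `|xᵃ| ≤ 1` on the closed unit cube (`|xⱼ| ≤ 1` factorwise). [folklore] -/
theorem tos_norm_mono_le_one {M : ℕ} {x : Fin M → ℝ} (hx : x ∈ KZ.cube M) (a : Fin M →₀ ℕ) :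
    ‖mono x a‖ ≤ 1 := by
  rw [mono, Finsupp.prod, norm_prod]
  refine Finset.prod_le_one (fun j _ => norm_nonneg _) fun j _ => ?_
  rw [norm_pow, Real.norm_eq_abs]
  have h := KZ.mem_cube.1 hx j
  exact pow_le_one₀ (abs_nonneg _) (abs_le.2 ⟨by linarith [h.1], h.2⟩)

/-- On the closed unit cube the series `∑ₐ Fₐ xᵃ` converges absolutely: `∑ₐ |Fₐ xᵃ| ≤ ∑ₐ |Fₐ|`.
[folklore] -/
theorem tos_summable_norm_term {M : ℕ} {F : MvPowerSeries (Fin M) ℝ} {ρ : ℝ} (hρ : 1 ≤ ρ)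
    (hF : Summable fun a : Fin M →₀ ℕ => |coeff a F| * ρ ^ (a.sum fun _ e => e))
    {x : Fin M → ℝ} (hx : x ∈ KZ.cube M) :
    Summable fun a : Fin M →₀ ℕ => ‖coeff a F * mono x a‖ :=
  Summable.of_nonneg_of_le (fun a => norm_nonneg _)
    (fun a => by
      rw [norm_mul]
      exact mul_le_of_le_one_right (norm_nonneg _) (tos_norm_mono_le_one hx a))
    (tos_summable_norm_coeff hρ hF)

/-! ## (A) Termwise integration over the cube -/

/-- `∫_{[0,1]} tⁿ dt = (n + 1)⁻¹`. [folklore] -/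
theorem tos_integral_pow_Icc (n : ℕ) : ∫ t in Icc (0 : ℝ) 1, t ^ n = ((n : ℝ) + 1)⁻¹ := by
  rw [integral_Icc_eq_integral_Ioc, ← intervalIntegral.integral_of_le zero_le_one, integral_pow]
  rw [one_pow, zero_pow (Nat.succ_ne_zero n), sub_zero, one_div]

/-- A monomial written as a product over all coordinates: `xᵃ = ∏ⱼ xⱼ^{aⱼ}`. [folklore] -/
theorem tos_mono_eq_prod {M : ℕ} (x : Fin M → ℝ) (a : Fin M →₀ ℕ) :
    mono x a = ∏ j, x j ^ (a j) :=
  Finsupp.prod_fintype _ _ fun _ => pow_zero _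

/-- **`∫_{[0,1]ᴹ} xᵃ dx = ∏ⱼ (aⱼ + 1)⁻¹`** (Fubini on the product cube). [Ayoub 2014, Rem. 13;
folklore] -/
theorem tos_integral_mono {M : ℕ} (a : Fin M →₀ ℕ) :
    ∫ x in KZ.cube M, mono x a = a.prod (fun _ e => ((e : ℝ) + 1)⁻¹) := by
  have h1 : (fun x : Fin M → ℝ => mono x a) = fun x => ∏ j, (fun (j : Fin M) (t : ℝ) => t ^ (a j)) j (x j) :=
    funext fun x => tos_mono_eq_prod x a
  rw [h1, Finsupp.prod_fintype _ _ (fun j => by rw [Nat.cast_zero, zero_add, inv_one]),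
    KZ.cube_eq_pi, volume_pi, Measure.restrict_pi_pi,
    integral_fintype_prod_eq_prod (𝕜 := ℝ) (fun (j : Fin M) (t : ℝ) => t ^ (a j))]
  exact Finset.prod_congr rfl fun j _ => tos_integral_pow_Icc (a j)

/-- Each term `x ↦ Fₐ xᵃ` is integrable on the cube (continuous on a compact set). [folklore] -/
theorem tos_integrable_term {M : ℕ} (F : MvPowerSeries (Fin M) ℝ) (a : Fin M →₀ ℕ) :
    Integrable (fun x : Fin M → ℝ => coeff a F * mono x a) (volume.restrict (KZ.cube M)) :=
  (((continuous_mono a).const_mul (coeff a F)).continuousOn).integrableOn_compact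
    KZ.isCompact_cube

/-- `∫_{[0,1]ᴹ} |Fₐ xᵃ| dx ≤ |Fₐ|`. [folklore] -/
theorem tos_integral_norm_term_le {M : ℕ} (F : MvPowerSeries (Fin M) ℝ) (a : Fin M →₀ ℕ) :
    ∫ x in KZ.cube M, ‖coeff a F * mono x a‖ ≤ ‖coeff a F‖ := by
  have h := norm_setIntegral_le_of_norm_le_const (μ := (volume : Measure (Fin M → ℝ)))
    (s := KZ.cube M) (f := fun x : Fin M → ℝ => ‖coeff a F * mono x a‖) (C := ‖coeff a F‖)
    (by rw [KZ.volume_cube]; exact ENNReal.one_lt_top)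
    (fun x hx => by
      rw [norm_norm, norm_mul]
      exact mul_le_of_le_one_right (norm_nonneg _) (tos_norm_mono_le_one hx a))
  rw [KZ.volume_real_cube, mul_one] at h
  exact (Real.le_norm_self _).trans h

/-- **(A) Termwise integration.** If `∑ₐ |Fₐ| ρ^{|a|} < ∞` for some `ρ > 1` and `∑ₐ Fₐ xᵃ = g x`
on `[0,1]ᴹ`, then `∑ₐ Fₐ ∏ⱼ (aⱼ + 1)⁻¹ = ∫_{[0,1]ᴹ} g` (the sum of the integrals of the absolutely
integrable terms is the integral of the sum). [Ayoub 2014, Rem. 13; folklore] -/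
theorem tos_hasSum_integral {M : ℕ} {F : MvPowerSeries (Fin M) ℝ} {ρ : ℝ} (hρ : 1 < ρ)
    (hF : Summable fun a : Fin M →₀ ℕ => |coeff a F| * ρ ^ (a.sum fun _ e => e))
    {g : (Fin M → ℝ) → ℝ}
    (hg : ∀ x ∈ KZ.cube M, HasSum (fun a : Fin M →₀ ℕ => coeff a F * a.prod (fun j e => x j ^ e))
      (g x)) :
    HasSum (fun a : Fin M →₀ ℕ => coeff a F * a.prod (fun _ e => ((e : ℝ) + 1)⁻¹))
      (∫ x in KZ.cube M, g x) := by
  have hsum : Summable fun a : Fin M →₀ ℕ => ∫ x in KZ.cube M, ‖coeff a F * mono x a‖ :=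
    Summable.of_nonneg_of_le (fun a => integral_nonneg fun x => norm_nonneg _)
      (tos_integral_norm_term_le F) (tos_summable_norm_coeff hρ.le hF)
  have h := hasSum_integral_of_summable_integral_norm (tos_integrable_term F) hsum
  have h2 : ∫ x in KZ.cube M, (∑' a : Fin M →₀ ℕ, coeff a F * mono x a) = ∫ x in KZ.cube M, g x :=
    setIntegral_congr_fun KZ.measurableSet_cube fun x hx => (hg x hx).tsum_eq
  rw [h2] at h
  refine h.congr_fun fun a => ?_
  show _ = ∫ x in KZ.cube M, coeff a F * mono x a
  rw [integral_const_mul, tos_integral_mono]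

/-! ## (B) Termwise restriction to `xᵢ = c` -/

/-- If `aᵢ = 0`, the monomial `xᵃ` does not see the `i`-th coordinate:
`(x with xᵢ ↦ t)ᵃ = xᵃ`. [folklore] -/
theorem tos_mono_update_of_apply_eq_zero {M : ℕ} (x : Fin M → ℝ) (i : Fin M) (t : ℝ)
    {a : Fin M →₀ ℕ} (ha : a i = 0) : mono (Function.update x i t) a = mono x a := by
  unfold mono
  refine Finsupp.prod_congr fun j hj => ?_
  have hji : j ≠ i := fun h => (Finsupp.mem_support_iff.1 hj) (h ▸ ha)
  rw [Function.update_of_ne hji]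

/-- `(a + n eᵢ) ∖ i = a ∖ i`. [folklore] -/
theorem tos_erase_add_single_self {M : ℕ} (a : Fin M →₀ ℕ) (i : Fin M) (n : ℕ) :
    (a + Finsupp.single i n).erase i = a.erase i := by
  -- adapted from `AyoubRel.erase_add_single_self`
  rw [Finsupp.erase_add, Finsupp.erase_single, add_zero]

/-- **(B) Termwise restriction.** If `∑ₐ |Fₐ| ρ^{|a|} < ∞` for some `ρ > 1` and `∑ₐ Fₐ xᵃ = g x`
on `[0,1]ᴹ`, then for `0 ≤ c ≤ 1` and `x ∈ [0,1]ᴹ` the series regrouped along the `i`-th exponent,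
`∑_{a, aᵢ = 0} (∑ₙ F_{a + n eᵢ} cⁿ) xᵃ`, sums to `g (x with xᵢ ↦ c)` (Fubini for the absolutely
convergent family `b ↦ F_b (x with xᵢ ↦ c)ᵇ`, reindexed by `b = a + n eᵢ`, `aᵢ = 0`).
[AyoubRelKZRevisited, Lemme 1.4; folklore] -/
theorem tos_hasSum_restrict {M : ℕ} {F : MvPowerSeries (Fin M) ℝ} {ρ : ℝ} (hρ : 1 < ρ)
    (hF : Summable fun a : Fin M →₀ ℕ => |coeff a F| * ρ ^ (a.sum fun _ e => e))
    {g : (Fin M → ℝ) → ℝ}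
    (hg : ∀ x ∈ KZ.cube M, HasSum (fun a : Fin M →₀ ℕ => coeff a F * a.prod (fun j e => x j ^ e))
      (g x))
    (i : Fin M) {c : ℝ} (hc₀ : 0 ≤ c) (hc₁ : c ≤ 1) {x : Fin M → ℝ} (hx : x ∈ KZ.cube M) :
    HasSum (fun a : Fin M →₀ ℕ => (if a i = 0 then
        ∑' n : ℕ, coeff (a + Finsupp.single i n) F * c ^ n else 0) * a.prod (fun j e => x j ^ e))
      (g (Function.update x i c)) := by
  set y : Fin M → ℝ := Function.update x i c with hy
  have hyc : y ∈ KZ.cube M := KZ.update_mem_cube hx i hc₀ hc₁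
  have hyi : y i = c := by rw [hy, Function.update_self]
  -- the absolutely convergent family `f b = F_b yᵇ` with sum `g y`
  have hfs : Summable fun b : Fin M →₀ ℕ => ‖coeff b F * mono y b‖ :=
    tos_summable_norm_term hρ.le hF hyc
  have hfy : HasSum (fun b : Fin M →₀ ℕ => coeff b F * mono y b) (g y) := hg y hyc
  -- spread it over `(a, n)` with `aᵢ = 0` via `b = a + n eᵢ`
  set h : (Fin M →₀ ℕ) × ℕ → ℝ := fun p => if p.1 i = 0 then
    coeff (p.1 + Finsupp.single i p.2) F * mono y (p.1 + Finsupp.single i p.2) else 0 with hh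
  set ψ : (Fin M →₀ ℕ) → (Fin M →₀ ℕ) × ℕ := fun b => (b.erase i, b i) with hψ
  have hψinj : Function.Injective ψ := by
    intro b b' e
    simp only [hψ, Prod.mk.injEq] at e
    rw [← Finsupp.erase_add_single i b, ← Finsupp.erase_add_single i b', e.1, e.2]
  have hψcomp : ∀ b, h (ψ b) = coeff b F * mono y b := by
    intro b
    simp only [hh, hψ, Finsupp.erase_same, if_true, Finsupp.erase_add_single]
  have hrange : ∀ p, p ∉ Set.range ψ → h p = 0 := by
    rintro ⟨a, n⟩ hp
    simp only [hh]
    split_ifs with ha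
    · exact absurd ⟨a + Finsupp.single i n, by
        simp only [hψ, Prod.mk.injEq, tos_erase_add_single_self, Finsupp.add_apply,
          Finsupp.single_eq_same, ha, zero_add, and_true]
        exact Finsupp.erase_of_notMem_support (by simpa using ha)⟩ hp
    · rfl
  have hH : HasSum h (g y) := by
    refine (hψinj.hasSum_iff hrange).1 ?_
    have : h ∘ ψ = fun b => coeff b F * mono y b := funext hψcomp
    rw [this]
    exact hfy
  have hHn : Summable fun p => ‖h p‖ := by
    refine (hψinj.summable_iff (f := fun p => ‖h p‖) fun p hp => by
      show ‖h p‖ = 0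
      rw [hrange p hp, norm_zero]).1 ?_
    have : (fun p => ‖h p‖) ∘ ψ = fun b => ‖coeff b F * mono y b‖ :=
      funext fun b => by simp only [Function.comp_apply, hψcomp]
    rw [this]
    exact hfs
  -- Fubini: sum first over `n`, then over `a`
  have hreg : HasSum (fun a : Fin M →₀ ℕ => ∑' n : ℕ, h (a, n)) (g y) :=
    hH.prod_fiberwise fun a => (hHn.of_norm.prod_factor a).hasSum
  refine hreg.congr_fun fun a => ?_
  by_cases ha : a i = 0
  · simp only [hh, if_pos ha]
    rw [← tsum_mul_right]
    refine tsum_congr fun n => ?_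
    rw [mono_add, mono_single, hyi, tos_mono_update_of_apply_eq_zero x i c ha]
    show _ * a.prod (fun j e => x j ^ e) = _ * (a.prod (fun j e => x j ^ e) * _)
    ring
  · simp only [hh, if_neg ha, tsum_zero, zero_mul]

end Helpers

open Set MeasureTheory
open Literature.NumberTheory.Transcendental
open Literature.NumberTheory.Transcendental.KZ hiding cubicalSpan
open Summit.KontsevichZagierPeriods.KontsevichZagierPeriods.Theses.FurushoPentagon

/-- **S3c (termwise integration over the cube and termwise restriction `xᵢ = c`).** For a real
power series with summable majorant of polyradius `ρ > 1` summing to `g` on `[0,1]ᴹ`: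
`∫_{[0,1]ᴹ} g = Σₐ cₐ ∏ⱼ (aⱼ + 1)⁻¹` (dominated convergence), and for `0 ≤ c ≤ 1`, `x ∈ [0,1]ᴹ`
the series regrouped along the `i`-th exponent sums to `g (x with xᵢ ↦ c)` (Fubini for absolutely
convergent series). [Ayoub 2014, Rem. 13; AyoubRelKZRevisited, Lemme 1.4; folklore] -/
theorem stub_termwiseOfSummable :
    ∀ (M : ℕ) (F : MvPowerSeries (Fin M) ℝ) (ρ : ℝ), 1 < ρ → Summable (fun a : Fin M →₀ ℕ => |MvPowerSeries.coeff a F| * ρ ^ (a.sum fun _ e => e)) → ∀ (g : (Fin M → ℝ) → ℝ), (∀ x ∈ KZ.cube M, HasSum (fun a : Fin M →₀ ℕ => MvPowerSeries.coeff a F * a.prod (fun j e => x j ^ e)) (g x)) → HasSum (fun a : Fin M →₀ ℕ => MvPowerSeries.coeff a F * a.prod (fun _ e => ((e : ℝ) + 1)⁻¹)) (∫ x in KZ.cube M, g x) ∧ ∀ (i : Fin M) (c : ℝ), 0 ≤ c → c ≤ 1 → ∀ x ∈ KZ.cube M, HasSum (fun a : Fin M →₀ ℕ => (if a i = 0 then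 ∑' n : ℕ, MvPowerSeries.coeff (a + Finsupp.single i n) F * c ^ n else 0) * a.prod (fun j e => x j ^ e)) (g (Function.update x i c)) := by
  intro M F ρ hρ hF g hg
  exact ⟨tos_hasSum_integral hρ hF hg,
    fun i c hc₀ hc₁ x hx => tos_hasSum_restrict hρ hF hg i hc₀ hc₁ hx⟩

end Summit.KontsevichZagierPeriods.FurushoPentagon.SectorToKernel
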